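import Summits.BirchSwinnertonDyer.BirchSwinnertonDyer.Theorems.WildThreeRankOneBSDpOfJetchevMax
import Summits.BirchSwinnertonDyer.BirchSwinnertonDyer.Theorems.Rank1ResidualJetCarrierEndFormsSwapFinal
import Summits.BirchSwinnertonDyer.BirchSwinnertonDyer.Theorems.Rank1ResidualJetCarrierPIndexKernel
import Summits.BirchSwinnertonDyer.BirchSwinnertonDyer.Theorems.AdditiveWildRankOneTowerSurjOfKato
import Summits.BirchSwinnertonDyer.Rank1Residual.JET.McCallumProp44ByName
import Literature.NumberTheory.GaloisCohomology.PoitouTateSumTotallyComplex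
import HarnessLib

/-!
# RUNG J_max@3 ⟸ THREE NAMED PRINT STATEMENTS (the `bsd-jet` road-K kernel, read in the wild row's
# currency), and the SINGLE-CARRIER JET sub-leaf of W-ALL row 2·3@3 ⟸ named print + the rank-zero wild leaf
# — NO Kolyvagin-side research input left on that sub-leaf (route-free; cell `bsd-wall`, D-0131 (3) M-UTD,
# seat `bsd-wall-utd-p3` gen 3; `--supports stmt-BirchSwinnertonDyer-20760` = SOED crux J, line `jetchev-max`)

FINDING (this seat, 2026-08-27T21:2xZ). The registered stub `stub_jetchevMaxAtThree` of line `jetchev-max` on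
SOED's crux J 20760 (skeleton `Cruxes/WildSigmaDivisibilityAtThree`, this seat) — Jetchev 2008 Thm. 1.4 read
at `p = 3 ∣ N` in monotone max-form and point currency — is NOT an L-sized port waiting to be done: the cell
`bsd-jet` (road K, seats pv-1/pv-2, 2026-08-26/27) has kernel-proved Jetchev's §§4–6 at EVERY bad `p ∣ N` and
EVERY carrier `q ∣ N` — `q ≠ p` (K1 `JET.JetchevDivisibilityCarrierNe`), `q = p` multiplicative (K3), `q = p`
ADDITIVE, Kodaira IV/IV*, `c₃ = 3` (K4 `JET.JetchevDivisibilityCarrierAdd`; the stringency step at `v ∣ 3` by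
the x11b3 tree theorem `X11b.Three.JetchevKummer.localKummerMap_mem_connectedKummerCondition_of_cocycle_of_hasAdditiveReduction`,
whose algebraic core this seat restated as `JetchevStringency.stringent_of_unramifiedDescent`, p569349 §1) —
MODULO EXACTLY three named print statements (`Rank1ResidualJetCarrierEndFormsSwapFinal`, pv-2 g6 p558893:
`JET.jetchevDivisibilityCarrier{Ne,Mult,Add}_of_swapLiterature hPT hF1 h372`):
  (PT)  `poitouTate_selmerStructure_duality_conj K` for every number field `K` (Poitou–Tate global duality for
        Selmer structures, Milne ADT I.4.10 / Howard 2004 Thm. 2.1.11);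
  (F1)  `Gross1991_heegnerPoint_sub_ratTorsion_mem_E0` (Gross–Zagier III (3.1) / Jetchev Cor. 3.2: the
        Heegner point minus a rational torsion point lies in `E⁰` at the bad places);
  (3.7) `GrossLMS1991.prop37_2_frobeniusCongruence` (Gross 1991 Prop. 3.7 (2)).
* §1 **`jetchevMaxAtThree_of_literature : (PT) → (F1) → (3.7) → ⟨stub_jetchevMaxAtThree, VERBATIM⟩`** — the
  registered stub's text under J's binders (`ClassO6`, `ρ̄₃` onto, `r_an = 1`, Heegner datum with `P = y_K` of
  infinite order, odd `d_K ≠ −3`, `TowerSurjThree`), from `JET.jetchevDivisibility_of_carrierNe_of_carrierMult_of_carrierAdd`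
  fed by the three END FORMS (bridges: non-CM from the tower, the conductor-`1` Kolyvagin datum with bottom point
  `P` by Darmon 3.6 / Shimura reciprocity — tree theorems —, `TowerSurjThree ⟹ ∀ n` by kmc g20's lemma).
* §2 **`bsdp_three_of_singleCarrier_of_literature_of_wAllExclAddWildRankZero`** — THE SINGLE-CARRIER JET
  SUB-LEAF CLASS THEOREM with NO displayed research input on the Kolyvagin side and NO McCallum Cor. 5.6: for `E`
  on `ClassO6 W 3`, `r_an = 1`, `ρ_{E,3^n}` onto ∀ `n`, ONE Heegner datum (odd `d_K`, `L(E^{d_K},1) ≠ 0`) with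
  JET-exact index `ord₃[E(K):ℤP] = ord₃ ∏_ℓ c_ℓ + v₃(c)` carried by ONE prime `q₀ ∣ N`
  (`ord₃ ∏_ℓ c_ℓ + v₃(c) ≤ ord₃ c_{q₀}`): {(PT), (F1), (3.7)} + {Gross–Zagier, Kolyvagin (rank one over `K`), GZK,
  modularity, GZ86 I.(7.3)} (named) + the leaf `WAllExclAddWildRankZero` (hypothesis) ⟹ `BSDp W 3`. Proof:
  §1 at depth `M₀ = ord₃[E(K):ℤP]` (McCallum Lemma 5.1, tree) ⟹ pv-1's divided descent
  `JET.DividedDescent.sha_primary_eq_bot_of_globalDivisibility` (its Poitou–Tate input is the TREE THEOREM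
  `poitouTate_sum_localTatePairing_eq_zero_of_isTotallyComplex`; [McC] 4.4 ⟸ (3.7) by
  `JET.prop44_of_frobeniusCongruence`) ⟹ `Ш(E/K)[3^∞] = ⊥` ⟹ both index sockets at slack `v₃(c)` ⟹ kmc g17's
  `bsdp_three_of_exactIndexManin_of_wAllExclAddWildRankZero` (p528981).
  `…_of_mcCallum` — the same through McCallum Cor. 5.6 (p569349 §2 with `hJmax` discharged), for comparison.

HONEST FRAMING / PARTITION. On the single-carrier JET rows of the onto-W wild rank-one residue at 3 (census
`JET@p∣N` literal rows with ONE 3-Tamagawa prime — `q₀ = 3` with Kodaira IV/IV* or ONE split multiplicative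
`ℓ` with `3 ∣ c_ℓ` — and `3 ∤ c(Dt)`; count = census ask Q-SC1 below) the Kolyvagin side is now in the SAME state
as on the coprime sub-leaf of gen 0: named print only. Everything there hinges on leaf #6 (`BSD₃` of the rank-zero
wild twist `E^{d_K}`), exactly as `bsdp_iff_partner_bsdp_of_exactIndexManin` (gen 0 §4) says. Multi-carrier rows
(≥ 2 primes with `3 ∣ c_q`, or `3 ∣ c`) keep the research stub `stub_beyondMax` (Büyükboduk 2009 §4.2 Q1).
CONDITIONAL on the named facts (hypotheses) and on leaf #6; per datum; closes no item and no class by itself;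
«beyond-print theorem»: NO (the three JET facts are print; J_max@3 itself is not in print but is kernel-proved
from them). BSD is not proved for any curve by this file. No definition, no named fact, no `sorry`.

References: [Jetchev2008] Thm. 1.4, Cor. 1.5, Cor. 3.2, Prop. 4.9, Thm. 6.3 (arXiv:math/0703431);
[McCallumLMS1991] Lemma 5.1, Prop. 4.4, Cor. 5.6; [GrossLMS1991] Prop. 3.7 (2), §10; [GrossZagier1986] III (3.1);
[MilneADT2006] I Thm. 4.10; [Howard2004HeegnerKolyvagin] Thm. 2.1.11; [JetchevSkinnerWan2017] §7.4.1.
-/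

noncomputable section

open scoped Classical

set_option linter.dupNamespace false
set_option autoImplicit false

namespace Summit.BirchSwinnertonDyer.BirchSwinnertonDyer.Theorems.SchneiderFree.Exact

open WeierstrassCurve NumberField IsDedekindDomain Field
  Literature.NumberTheory.EllipticCurves
  Literature.NumberTheory.EllipticCurves.ModularForms
  Literature.NumberTheory.EllipticCurves.Rank1Residual
  Literature.NumberTheory.EllipticCurves.KrizLi2019
  Literature.NumberTheory.GaloisCohomology
  Summit.BirchSwinnertonDyer.Rank1Residual
  Summit.BirchSwinnertonDyer.Rank1Residual.Additive
  Summit.BirchSwinnertonDyer.Rank1Residual.X11b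
  Summit.BirchSwinnertonDyer.Rank1Residual.X11b.Three
  Summit.BirchSwinnertonDyer.BirchSwinnertonDyer.Theorems.UniversalToricDescentWaldspurgerFlat

/-! ### §1 The registered stub `stub_jetchevMaxAtThree` ⟸ (PT), (F1), (3.7) -/

/-- **RUNG J_max@3 from three named print statements.** Under the binders of SOED's crux J
`WildSigmaDivisibilityAtThree` (`ClassO6 W 3`, `ρ̄₃` onto, `r_an = 1`, `N = N_E`, `K` imaginary quadratic
Heegner for `N`, `L(E^{d_K},1) ≠ 0`, `P = y_K` of the datum `(Dt, H, ι)` of infinite order, `d_K` odd,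
`d_K ≠ −3`, `TowerSurjThree W`), for EVERY prime `q ∣ N` and every `s′ ≤ ord₃ c_q(E)`, every derived Heegner
point of a Kolyvagin–Heegner datum on the frame `(Dt, H.β, ι)` (square-free conductor over Zhang–Kolyvagin
primes of index `≥ s′`) is `3^{s′}`-divisible (`Koly.PDiv d 3 s′`) — the text of the registered stub
`stub_jetchevMaxAtThree` VERBATIM — GIVEN (PT) `poitouTate_selmerStructure_duality_conj` (∀ `K`), (F1)
`Gross1991_heegnerPoint_sub_ratTorsion_mem_E0`, (3.7) `GrossLMS1991.prop37_2_frobeniusCongruence`. Proof: the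
`bsd-jet` kernel `JET.jetchevDivisibility_of_carrierNe_of_carrierMult_of_carrierAdd` (Jetchev Thm. 1.4 at any
bad `p ∣ N`, by carrier cases) fed by the three END FORMS `JET.jetchevDivisibilityCarrier{Ne,Mult,Add}_of_swapLiterature`;
non-CM from the tower; conductor-`1` datum with bottom point `P` (Darmon 3.6, Shimura reciprocity — tree
theorems). [cite: Jetchev2008, Thm. 1.4 (arXiv:math/0703431 p. 3), Prop. 4.9, Thm. 6.3]
[cite: GrossLMS1991, Prop. 3.7 (2) and Prop. 6.2 (1)] [cite: McCallumLMS1991, Prop. 4.4, Prop. 5.2] -/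
theorem jetchevMaxAtThree_of_literature
    (hPT : ∀ (K : Type) [Field K] [NumberField K], poitouTate_selmerStructure_duality_conj K)
    (hF1 : Gross1991_heegnerPoint_sub_ratTorsion_mem_E0)
    (h372 : GrossLMS1991.prop37_2_frobeniusCongruence) :
    ∀ (W : WeierstrassCurve ℚ) [W.IsElliptic] [W.IsGloballyMinimal] (N : ℕ) [NeZero N] (K : Type) [Field K]
      [NumberField K] (Dt : Literature.NumberTheory.EllipticCurves.ModularForms.ModularParametrizationData W N)
      (H : Literature.NumberTheory.EllipticCurves.HeegnerDatum N (NumberField.discr K)) (ι : K →+* ℂ)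
      (P : (W.baseChange K).toAffine.Point),
      Summit.BirchSwinnertonDyer.Rank1Residual.Additive.ClassO6 W 3 → W.HasSurjectiveModNGaloisRep 3 →
      W.analyticRank = 1 → W.conductorNorm ℤ = N →
      Literature.NumberTheory.EllipticCurves.IsImaginaryQuadratic K →
      Literature.NumberTheory.EllipticCurves.SatisfiesHeegnerHypothesis N K →
      (W.quadraticTwist (NumberField.discr K : ℚ)).entireLFunction 1 ≠ 0 →
      (WeierstrassCurve.Affine.Point.map ι.toRatAlgHom) P =
        Literature.NumberTheory.EllipticCurves.ModularForms.heegnerPointComplex Dt H →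
      ¬ IsOfFinAddOrder P → Odd (NumberField.discr K) → NumberField.discr K ≠ -3 →
      Summit.BirchSwinnertonDyer.Rank1Residual.AdditiveThree.TowerSurjThree W →
      ∀ (q : ℕ) [Fact q.Prime], q ∣ N →
      ∀ (s' : ℕ), s' ≤ padicValNat 3 ((W.baseChange ℚ_[q]).localTamagawaNumber ℤ_[q]) →
      ∀ (n : ℕ) (d : Literature.NumberTheory.EllipticCurves.KolyvaginHeegnerData Dt H.β ι n), Squarefree n →
        (∀ ℓ ∈ n.primeFactors, Literature.NumberTheory.EllipticCurves.Zhang2014.IsKolyvaginPrime N W K 3 ℓ ∧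
          s' ≤ Literature.NumberTheory.EllipticCurves.Zhang2014.kolyvaginIndex W 3 ℓ) →
        Summit.BirchSwinnertonDyer.Rank1Residual.X11b.Three.Koly.PDiv d 3 s' := by
  intro W _ _ N _ K _ _ Dt H ι P hO6 _hsurj _hr hN hK hHH _hLd hP hnt hodd h3 htow q _ hqN s' hs' n d hn hℓ
  subst hN
  -- `d_K ≠ -4` (odd), the tower for every `n`, non-CM, additive at `3`
  have h4 : NumberField.discr K ≠ -4 := by
    intro h
    rw [h] at hodd
    exact (Int.not_odd_iff_even.mpr ⟨-2, by norm_num⟩) hodd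
  have htower : ∀ m : ℕ, W.HasSurjectiveModNGaloisRep (3 ^ m : ℕ) :=
    forall_hasSurjectiveModNGaloisRep_pow_three_of_towerSurjThree W htow
  have hcm : ¬ W.HasCM := JET.not_hasCM_of_tower W 3 (by decide) htower
  have hbad : ¬ W.HasGoodReductionAtPrime 3 := not_good_of_addv W 3 hO6.2.1
  -- the conductor-`1` Kolyvagin–Heegner datum on the frame, with bottom point `P` (non-torsion)
  obtain ⟨d₁⟩ := exists_kolyvaginHeegnerData_one
    (phi_heegnerTau_mem_singularModuliField_holds (W.conductorNorm ℤ) W K) hK Dt H.β ι H.dvd_sq_sub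
  have hPd : d₁.toGeomPoints d₁.derivedPoint = toGeomPoints (W.baseChange K) P :=
    KolyvaginBottom.toGeomPoints_derivedPoint_one_eq
      (heegnerPointOfConductor_one_galoisConj_holds (W.conductorNorm ℤ) W K) hK hHH hP d₁ rfl
  have hy₁ : ¬ IsOfFinAddOrder d₁.derivedPoint := by
    intro hfo
    apply hnt
    have h1 : IsOfFinAddOrder (d₁.toGeomPoints d₁.derivedPoint) := d₁.toGeomPoints.isOfFinAddOrder hfo
    rw [hPd] at h1
    exact (toGeomPoints_injective (W.baseChange K)).isOfFinAddOrder_iff.mp h1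
  -- Jetchev Thm. 1.4 at the bad prime `3`, carrier `q`, from the three END FORMS
  exact JET.jetchevDivisibility_of_carrierNe_of_carrierMult_of_carrierAdd
    (JET.jetchevDivisibilityCarrierNe_of_swapLiterature hPT hF1 h372)
    (JET.jetchevDivisibilityCarrierMult_of_swapLiterature hPT hF1 h372)
    (JET.jetchevDivisibilityCarrierAdd_of_swapLiterature hPT hF1 h372)
    W hcm K hK h3 h4 hHH 3 (by decide) hbad htower Dt H.β ι d₁ hy₁ q hqN s' hs' n d hn hℓ

/-! ### §2 The SINGLE-CARRIER JET sub-leaf ⟸ named print + the rank-zero wild leaf -/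

/-- **Single-carrier JET sub-leaf, McCallum road**: p569349 §2 with its displayed input `hJmax` DISCHARGED by
§1 — {(PT), (F1), (3.7)} + McCallum Cor. 5.6 + {GZ, Kolyvagin, GZK, modularity, GZ86 I.(7.3)} (named) + leaf #6
⟹ `BSDp W 3` on a JET-exact, single-carrier Heegner datum of the onto wild rank-one row at `3`.
[cite: Jetchev2008, Thm. 1.4, Cor. 1.5 (arXiv:math/0703431 p. 3)] [cite: McCallumLMS1991, §5 Cor. 5.6 (p. 310)]
[cite: JetchevSkinnerWan2017, §7.4.1 (arXiv:1512.06894 p. 30)] -/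
theorem bsdp_three_of_singleCarrier_of_literature_of_mcCallum_of_wAllExclAddWildRankZero
    (hPT : ∀ (K : Type) [Field K] [NumberField K], poitouTate_selmerStructure_duality_conj K)
    (hF1 : Gross1991_heegnerPoint_sub_ratTorsion_mem_E0)
    (h372 : GrossLMS1991.prop37_2_frobeniusCongruence)
    (hGZ : ∀ (N : ℕ) [NeZero N] (W : WeierstrassCurve ℚ) (K : Type) [Field K] [NumberField K],
      gross_zagier N W K)
    (hKo : ∀ (N : ℕ) [NeZero N] (W : WeierstrassCurve ℚ) (K : Type) [Field K] [NumberField K],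
      kolyvagin N W K)
    (hGZK : rank_eq_analyticRank_of_analyticRank_le_one) (hmod : hasEntireLFunction_rat)
    (hGZ73 : GrossZagier1986_thm_I_7_3)
    (hMcU : McCallum1991_padicValNat_card_sha_primary_add_le_of_globalDivisibility)
    (hRZ : Summit.BirchSwinnertonDyer.WAllExclAddWildRankZero)
    (W : WeierstrassCurve ℚ) [W.IsElliptic] [W.IsGloballyMinimal] [NeZero (W.conductorNorm ℤ)]
    (hO6 : ClassO6 W 3) (hρ : ∀ n : ℕ, W.HasSurjectiveModNGaloisRep (3 ^ n : ℕ)) (hr : W.analyticRank = 1)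
    (K : Type) [Field K] [NumberField K]
    (Dt : ModularParametrizationData W (W.conductorNorm ℤ))
    (H : HeegnerDatum (W.conductorNorm ℤ) (NumberField.discr K)) (ι : K →+* ℂ)
    (P : (W.baseChange K).toAffine.Point)
    (hK : IsImaginaryQuadratic K) (hodd : Odd (NumberField.discr K))
    (hHH : SatisfiesHeegnerHypothesis (W.conductorNorm ℤ) K)
    (hLd : (W.quadraticTwist (NumberField.discr K : ℚ)).entireLFunction 1 ≠ 0)
    (hP : WeierstrassCurve.Affine.Point.map ι.toRatAlgHom P = heegnerPointComplex Dt H)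
    (hI : padicValNat 3 (AddSubgroup.zmultiples P).index =
      padicValNat 3 W.tamagawaProduct + padicValNat 3 Dt.c.natAbs)
    {q₀ : ℕ} [Fact q₀.Prime] (hq₀ : q₀ ∣ W.conductorNorm ℤ)
    (hcar : padicValNat 3 W.tamagawaProduct + padicValNat 3 Dt.c.natAbs ≤
      padicValNat 3 ((W.baseChange ℚ_[q₀]).localTamagawaNumber ℤ_[q₀])) :
    BSDp W 3 := by
  have hsurj : W.HasSurjectiveModNGaloisRep 3 := by simpa using hρ 1
  have htow : AdditiveThree.TowerSurjThree W := fun n _ ↦ hρ n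
  have h3N : 3 ∣ W.conductorNorm ℤ :=
    (W.dvd_conductorNorm_iff_not_hasGoodReductionAtPrime 3).mpr (not_good_of_addv W 3 hO6.2.1)
  have h3 : NumberField.discr K ≠ -3 := by
    intro h
    exact (X11b.Three.not_dvd_discr_and_not_dvd_torsionOrder_of_heegner hK hHH (by decide) h3N).1
      (h ▸ ⟨-1, by norm_num⟩)
  -- the Heegner point is non-torsion (Gross–Zagier)
  have hL0 : W.entireLFunction 1 = 0 := entireLFunction_one_eq_zero_of_analyticRank_eq_one hr
  obtain ⟨-, hderiv⟩ := leadingLCoeff_eq_deriv_of_analyticRank_eq_one hr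
  have hLK : LDerivEK W K ≠ 0 := by
    rw [lDerivEK_eq_deriv_mul W K hmod hL0]; exact mul_ne_zero hderiv hLd
  have hnt : ¬ IsOfFinAddOrder P :=
    (lDerivEK_ne_zero_iff_not_isOfFinAddOrder W (W.conductorNorm ℤ) K (hGZ _ W K) hK hHH
      ⟨Dt, H, ι, hP⟩).mp hLK
  exact bsdp_three_of_singleCarrier_of_jetchevMax_of_wAllExclAddWildRankZero hGZ hKo hGZK hmod hGZ73 hMcU hRZ W
    hO6 hρ hr K Dt H ι P hK hodd hHH hLd hP hI hq₀ hcar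
    (fun q _ hq s' hs' n d hn hℓ ↦ jetchevMaxAtThree_of_literature hPT hF1 h372 W (W.conductorNorm ℤ) K Dt H ι
      P hO6 hsurj hr rfl hK hHH hLd hP hnt hodd h3 htow q hq s' hs' n d hn hℓ)

/-- **THE SINGLE-CARRIER JET SUB-LEAF of W-ALL row 2·3@3 ⟸ NAMED PRINT + the rank-zero wild leaf — no McCallum
Cor. 5.6, no displayed research input on the Kolyvagin side.** For `E` (globally minimal `W`) on `ClassO6 W 3`
with `r_an = 1`, `ρ_{E,3^n}` onto for every `n`, ONE Heegner datum `(K, Dt, H, ι, P)` at level `N_E` — odd `d_K`,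
Heegner hypothesis, `L(E^{d_K},1) ≠ 0`, `P = y_K` — with JET-exact index
`ord₃[E(K):ℤP] = ord₃ ∏_ℓ c_ℓ(E) + v₃(c)` (`hI`) carried by ONE prime `q₀ ∣ N_E` (`hcar`): the three `bsd-jet`
road-K statements (PT) ∀ `K`, (F1), (3.7), the published inputs Gross–Zagier / Kolyvagin (rank one over `K`,
`Ш(E/K)` finite) / GZK / modularity / GZ86 I.(7.3) (all named, hypotheses) and the leaf
`WAllExclAddWildRankZero` (hypothesis; it pays `BSD₃` of a minimal model of the rank-zero wild twist `E^{d_K}`)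
give `BSDp W 3`. Proof: `M₀ := max{M : 3^M ∣ P in E(K)}` (Mordell–Weil) equals `ord₃[E(K):ℤP]` (McCallum
Lemma 5.1, tree; rank one by Kolyvagin, `E(K)[3] = 0` by irreducibility); §1 at the carrier `q₀` and depth
`M₀ ≤ ord₃ c_{q₀}` feeds pv-1's divided descent `JET.DividedDescent.sha_primary_eq_bot_of_globalDivisibility`
(Poitou–Tate sum formula = tree theorem at the totally complex `K`; [McC] 4.4 ⟸ (3.7)) ⟹ `Ш(E/K)[3^∞] = ⊥`
⟹ `ord₃ #Ш(E/K) = 0` ⟹ both index sockets at slack `v₃(c)` (arithmetic from `hI`) ⟹ kmc g17's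
`bsdp_three_of_exactIndexManin_of_wAllExclAddWildRankZero`. CONDITIONAL; per datum; closes nothing by itself.
[cite: Jetchev2008, Thm. 1.4, Cor. 1.5 (arXiv:math/0703431 p. 3)] [cite: McCallumLMS1991, §5 Lemma 5.1 (p. 303)]
[cite: GrossLMS1991, §10 and Prop. 3.7 (2)] [cite: JetchevSkinnerWan2017, §7.4.1 (arXiv:1512.06894 p. 30)]
[cite: GrossZagier1986, Thm. I.(6.3), III (3.1), V.§2] -/
theorem bsdp_three_of_singleCarrier_of_literature_of_wAllExclAddWildRankZero
    (hPT : ∀ (K : Type) [Field K] [NumberField K], poitouTate_selmerStructure_duality_conj K)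
    (hF1 : Gross1991_heegnerPoint_sub_ratTorsion_mem_E0)
    (h372 : GrossLMS1991.prop37_2_frobeniusCongruence)
    (hGZ : ∀ (N : ℕ) [NeZero N] (W : WeierstrassCurve ℚ) (K : Type) [Field K] [NumberField K],
      gross_zagier N W K)
    (hKo : ∀ (N : ℕ) [NeZero N] (W : WeierstrassCurve ℚ) (K : Type) [Field K] [NumberField K],
      kolyvagin N W K)
    (hGZK : rank_eq_analyticRank_of_analyticRank_le_one) (hmod : hasEntireLFunction_rat)
    (hGZ73 : GrossZagier1986_thm_I_7_3)
    (hRZ : Summit.BirchSwinnertonDyer.WAllExclAddWildRankZero)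
    (W : WeierstrassCurve ℚ) [W.IsElliptic] [W.IsGloballyMinimal] [NeZero (W.conductorNorm ℤ)]
    (hO6 : ClassO6 W 3) (hρ : ∀ n : ℕ, W.HasSurjectiveModNGaloisRep (3 ^ n : ℕ)) (hr : W.analyticRank = 1)
    (K : Type) [Field K] [NumberField K]
    (Dt : ModularParametrizationData W (W.conductorNorm ℤ))
    (H : HeegnerDatum (W.conductorNorm ℤ) (NumberField.discr K)) (ι : K →+* ℂ)
    (P : (W.baseChange K).toAffine.Point)
    (hK : IsImaginaryQuadratic K) (hodd : Odd (NumberField.discr K))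
    (hHH : SatisfiesHeegnerHypothesis (W.conductorNorm ℤ) K)
    (hLd : (W.quadraticTwist (NumberField.discr K : ℚ)).entireLFunction 1 ≠ 0)
    (hP : WeierstrassCurve.Affine.Point.map ι.toRatAlgHom P = heegnerPointComplex Dt H)
    (hI : padicValNat 3 (AddSubgroup.zmultiples P).index =
      padicValNat 3 W.tamagawaProduct + padicValNat 3 Dt.c.natAbs)
    {q₀ : ℕ} [Fact q₀.Prime] (hq₀ : q₀ ∣ W.conductorNorm ℤ)
    (hcar : padicValNat 3 W.tamagawaProduct + padicValNat 3 Dt.c.natAbs ≤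
      padicValNat 3 ((W.baseChange ℚ_[q₀]).localTamagawaNumber ℤ_[q₀])) :
    BSDp W 3 := by
  have hp : (3 : ℕ).Prime := by norm_num
  have hsurj : W.HasSurjectiveModNGaloisRep 3 := by simpa using hρ 1
  have htow : AdditiveThree.TowerSurjThree W := fun n _ ↦ hρ n
  have hcm : ¬ W.HasCM := JET.not_hasCM_of_tower W 3 (by decide) hρ
  have h3N : 3 ∣ W.conductorNorm ℤ :=
    (W.dvd_conductorNorm_iff_not_hasGoodReductionAtPrime 3).mpr (not_good_of_addv W 3 hO6.2.1)
  have h3 : NumberField.discr K ≠ -3 := by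
    intro h
    exact (X11b.Three.not_dvd_discr_and_not_dvd_torsionOrder_of_heegner hK hHH (by decide) h3N).1
      (h ▸ ⟨-1, by norm_num⟩)
  have h4 : NumberField.discr K ≠ -4 := by
    intro h
    rw [h] at hodd
    exact (Int.not_odd_iff_even.mpr ⟨-2, by norm_num⟩) hodd
  -- the Heegner point is non-torsion (Gross–Zagier); rank one and `Ш(E/K)` finite (Kolyvagin)
  have hL0 : W.entireLFunction 1 = 0 := entireLFunction_one_eq_zero_of_analyticRank_eq_one hr
  obtain ⟨-, hderiv⟩ := leadingLCoeff_eq_deriv_of_analyticRank_eq_one hr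
  have hLK : LDerivEK W K ≠ 0 := by
    rw [lDerivEK_eq_deriv_mul W K hmod hL0]; exact mul_ne_zero hderiv hLd
  have hnt : ¬ IsOfFinAddOrder P :=
    (lDerivEK_ne_zero_iff_not_isOfFinAddOrder W (W.conductorNorm ℤ) K (hGZ _ W K) hK hHH
      ⟨Dt, H, ι, hP⟩).mp hLK
  obtain ⟨hrank, hfin⟩ := hKo (W.conductorNorm ℤ) W K hK hHH ⟨Dt, H, ι, hP⟩ hnt
  haveI : Finite (W.baseChange K).sha := hfin
  -- no `3`-torsion in `E(K)`
  haveI : NeZero ((3 : ℕ) : ℚ) := ⟨by norm_num⟩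
  have hirr : W.HasIrreducibleModPGaloisRep 3 := hasIrreducibleModPGaloisRep_of_hasSurjectiveModNGaloisRep W 3 hsurj
  have hbot3 := torsionBy_eq_bot_of_isImaginaryQuadratic_of_hasIrreducibleModPGaloisRep W K hK hp hirr
  have hiv : ∀ x : (W.baseChange K).toAffine.Point, 3 • x = 0 → x = 0 := fun x hx ↦ by
    have hmem : x ∈ AddSubgroup.torsionBy (W.baseChange K).toAffine.Point ((3 : ℕ) : ℤ) := by
      rw [mem_torsionBy_iff, natCast_zsmul]
      exact hx
    rw [hbot3] at hmem
    exact hmem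
  -- `3^{M₀} ∥ P` (Mordell–Weil) and `M₀ = ord₃ [E(K):ℤP]` (McCallum Lemma 5.1)
  haveI : Module.Finite ℤ (W.baseChange K).toAffine.Point := (W.baseChange K).module_finite_point_holds
  obtain ⟨M₀, x₀, hx₀, hmax⟩ := exists_pow_smul_eq_and_forall_ne hnt (p := 3) hp.two_le
  have hdiv : ∃ Q : (W.baseChange K).toAffine.Point, ((3 ^ M₀ : ℕ) : ℤ) • Q = P :=
    ⟨x₀, by rw [natCast_zsmul]; exact hx₀⟩
  have hndiv : ¬ ∃ Q : (W.baseChange K).toAffine.Point, ((3 ^ (M₀ + 1) : ℕ) : ℤ) • Q = P := by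
    rintro ⟨Q, hQ⟩
    exact hmax Q (by rw [← natCast_zsmul]; exact hQ)
  haveI : Finite (AddCommGroup.torsion (W.baseChange K).toAffine.Point) :=
    WeierstrassCurve.finite_torsion_point (W := W.baseChange K)
  obtain ⟨c, Q, hcQ, hcker⟩ := RankOne.exists_coord_of_mordellWeilRank_eq_one (W.baseChange K) hrank
  have hidx : padicValNat 3 (AddSubgroup.zmultiples P).index = M₀ :=
    Koly.padicValNat_index_zmultiples_eq_of_divisibility c Q hcQ hcker hiv P hdiv hndiv
  have hM₀ : M₀ ≤ padicValNat 3 ((W.baseChange ℚ_[q₀]).localTamagawaNumber ℤ_[q₀]) := by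
    rw [← hidx, hI]; exact hcar
  -- the conductor-`1` datum with bottom point `P`, and global divisibility at depth `M₀` from §1
  obtain ⟨d₁⟩ := exists_kolyvaginHeegnerData_one
    (phi_heegnerTau_mem_singularModuliField_holds (W.conductorNorm ℤ) W K) hK Dt H.β ι H.dvd_sq_sub
  have hPd : d₁.toGeomPoints d₁.derivedPoint = toGeomPoints (W.baseChange K) P :=
    KolyvaginBottom.toGeomPoints_derivedPoint_one_eq
      (heegnerPointOfConductor_one_galoisConj_holds (W.conductorNorm ℤ) W K) hK hHH hP d₁ rfl
  have hGD : ∀ (n : ℕ) (d : KolyvaginHeegnerData Dt H.β ι n), Squarefree n →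
      (∀ ℓ ∈ n.primeFactors, Zhang2014.IsKolyvaginPrime (W.conductorNorm ℤ) W K 3 ℓ ∧
        M₀ ≤ Zhang2014.kolyvaginIndex W 3 ℓ) →
      ∃ Q : (W.baseChange (ringClassField K ι n)).toAffine.Point, ((3 ^ M₀ : ℕ) : ℤ) • Q = d.derivedPoint :=
    fun n d hn hℓ ↦ jetchevMaxAtThree_of_literature hPT hF1 h372 W (W.conductorNorm ℤ) K Dt H ι P hO6 hsurj
      hr rfl hK hHH hLd hP hnt hodd h3 htow q₀ hq₀ M₀ hM₀ n d hn hℓ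
  -- `Ш(E/K)[3^∞] = ⊥` by pv-1's divided descent (Poitou–Tate sum formula: tree theorem at totally complex `K`)
  haveI : NumberField.IsTotallyComplex K := hK.isTotallyComplex
  have hsha : AddCommGroup.primaryComponent (W.baseChange K).sha 3 = ⊥ :=
    JET.DividedDescent.sha_primary_eq_bot_of_globalDivisibility W hcm K hK h3 h4 hHH 3 (by decide) hρ Dt H.β ι
      d₁ P hPd ⟨Dt, H, ι, hP⟩ hnt M₀ hndiv hGD (poitouTate_sum_localTatePairing_eq_zero_of_isTotallyComplex K)
      (JET.prop44_of_frobeniusCongruence h372) hF1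
  have hsha0 : padicValNat 3 (W.baseChange K).shaOrder = 0 := by
    rw [Koly.padicValNat_shaOrder_eq (W.baseChange K) 3, hsha, AddSubgroup.card_bot, padicValNat_one_right]
  -- both sockets at slack `v₃(c)`
  have hup : Upper.IndexUpperBoundLeAt W 3 K P (padicValNat 3 Dt.c.natAbs) := by
    unfold Upper.IndexUpperBoundLeAt; omega
  have hlo : IndexLowerBoundLeAt W 3 K P (padicValNat 3 Dt.c.natAbs) := by
    unfold IndexLowerBoundLeAt; omega
  -- a globally minimal model of the twist, then kmc g17's descent with the rank-zero wild leaf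
  have hD0 : (NumberField.discr K : ℚ) ≠ 0 := by exact_mod_cast NumberField.discr_ne_zero K
  haveI : (W.quadraticTwist (NumberField.discr K : ℚ)).IsElliptic := W.isElliptic_quadraticTwist hD0
  obtain ⟨Cd, hCd⟩ := hasGlobalMinimalModel_rat_holds (W.quadraticTwist (NumberField.discr K : ℚ))
  haveI : (Cd • W.quadraticTwist (NumberField.discr K : ℚ)).IsGloballyMinimal := hCd
  exact bsdp_three_of_exactIndexManin_of_wAllExclAddWildRankZero hGZ hKo hGZK hmod hGZ73 hRZ W hO6 hsurj hr
    (W.conductorNorm ℤ) K Dt H ι P (Cd • W.quadraticTwist (NumberField.discr K : ℚ)) rfl hK hodd hHH hLd hP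
    ⟨Cd, rfl⟩ hlo hup

end Summit.BirchSwinnertonDyer.BirchSwinnertonDyer.Theorems.SchneiderFree.Exact

end
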